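import Mathlib
import HarnessLib

/-!
# Rational polyhedral structures in tropical projective space and cellular tropical homology

Layer `Literature/AlgebraicGeometry/Tropical`. Real definitions (no facts, no theorems) of the
combinatorial objects of tropical homology in the generality needed to STATE questions about
tropical cycles on extended tropical hypersurfaces `X̄ ⊆ 𝕋ℙ^{N-1}`
(Mikhalkin–Zharkov, Itenberg–Katzarkov–Mikhalkin–Zharkov, Amini–Piquerez):

* `TropPoint N`: points of tropical projective `(N-1)`-space in homogeneous tropical coordinates
  `u : Fin N → EReal`, never `⊥ = -∞`, not all `⊤ = +∞`; we do NOT quotient by the translation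
`u ↦ u + t•𝟙` — every set we build is translation-saturated — so that the product/order topology of
  `EReal` is available verbatim. The *sedentarity* of `u` is `{i | uᵢ = +∞}`.
* `TropCell N`: a presentation of a relatively open RATIONAL polyhedral cell of fixed sedentarity
  `I`: finitely many equations `⟨m, u⟩ = r` and strict inequalities `⟨m, u⟩ > r` with
  `m ∈ ℤ^N`, `Σ mᵢ = 0`, `m|_I = 0` (`TropCell.WellFormed`), `r ∈ ℝ` (irrational constants allowed:
  the complexes of interest are dual to regular subdivisions with irrational heights).
* tangent spaces: `TanQuot N I = ℝ^N ⧸ ⟨𝟙, e_i (i ∈ I)⟩`, the projections `prj I J` (`I ⊆ J`),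
  `TropCell.tangent σ ⊆ TanQuot N σ.sed`, `dimc σ = dim tangent σ`, and the pieces
  `wedgeSpan σ k = ⋀ᵏ T(σ)` inside the exterior algebra `Ext N I = ⋀• TanQuot N I`.
* a *polyhedral structure* is a `Finset (TropCell N)`; `IsStructureOf Q X` says its cells are
  well formed, non-empty, pairwise disjoint, cover `X`, and closures of cells are unions of cells.
* the multi-tangent coefficient spaces `multiTangent Q p σ = F_p(σ) = Σ_{ρ ≥ σ, sed ρ = sed σ} ⋀ᵖ T(ρ)`
  (Mikhalkin–Zharkov Def. 2.1), cellular `(p, q)`-chains `chains Q p q` (one coefficient in `F_p(σ)`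
  per `q`-cell `σ`), the cellular boundary `boundary Q` built from FIXED (chosen once, by choice)
  orientations `orient σ ∈ ⋀^{dim σ} T(σ)` and the incidence numbers `inc σ τ ∈ {0, ±1}` of
  codimension-one face pairs, finite or at infinity (for a face at infinity the relative-interior
  direction is replaced by minus the recession ray and the coefficient is pushed by `prj`,
  Mikhalkin–Zharkov §2.2), and `tropHomology Q p q = ker ∂ ∩ C_{p,q} ⧸ ∂ C_{p,q+1}`.
* `TropCycle Q p`: a real weighting `w` of the `p`-cells whose fundamental chain
  `σ ↦ w σ • orient σ` is CLOSED; for polyhedral structures closedness of the fundamental chain is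
exactly the weighted balancing condition (Mikhalkin–Zharkov Prop. 4.3: the fundamental chain of a
weighted balanced complex is a cycle), and with free real
  weights the normalisation of `orient σ` (lattice volume or not) is immaterial. `TropCycle.cls` is
  its class in `tropHomology Q p p`, `TropCycle.support` the union of the closed cells it charges.
* `tropHypersurface S ht`: the extended tropical hypersurface in `TropPoint N` of the tropical
  polynomial `min_{s ∈ S} (ht s + ⟨s, u⟩)` (min attained twice, value finite), and
  `RegularUnimodular S ht`: every full-dimensional cell of the regular subdivision of `S` induced by
the heights `ht` is a simplex with `N` vertices whose edge vectors generate the lattice generated by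
  all differences of `S` (unimodular for the lattice `M_S = ℤ⟨S - S⟩`; equivalently the dual tropical
  hypersurface is smooth for the dual lattice `N_S = M_S^∨`).

Design choices. Everything is over `ℝ` (weights, chains): the questions these definitions serve
concern DIMENSIONS OF SPANS of cycle classes, which are insensitive to the coefficient field and to
the lattice normalisations. Orientations are chosen by `Classical.choice`; homology and the span of
cycle classes do not depend on the choice (a change of `orient σ` changes the `σ`-coordinate of every
chain and every incidence number `inc σ τ`, `inc ρ σ` by the same sign). Decidability is classical
throughout; nothing here computes.

NOT here: the comparison with singular tropical homology, Poincaré duality, the tropical cycle class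
map beyond fundamental chains of weighted subcomplexes, intersection products.

References: G. Mikhalkin, I. Zharkov, *Tropical eigenwave and intermediate Jacobians*, §2
[MikhalkinZharkov2014Eigenwave]; O. Amini, M. Piquerez, arXiv:2012.13142, §2–§3
[AminiPiquerez2020TropicalHC]; D. Maclagan, B. Sturmfels, *Introduction to Tropical Geometry*,
§2.3, §3.1, §6.2 [MaclaganSturmfels2015].
-/

noncomputable section

open scoped Classical

namespace Literature.AlgebraicGeometry.Tropical

variable (N : ℕ)

/-! ### Points of tropical projective space -/

/-- Homogeneous tropical coordinates of a point of `𝕋ℙ^{N-1}`: `u : Fin N → EReal` with no `-∞`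
coordinate and not all coordinates `+∞` (translation by `ℝ•𝟙` is NOT quotiented out; all sets below
are translation-saturated). [cite: MaclaganSturmfels2015, §6.2] -/
abbrev TropPoint : Type := {u : Fin N → EReal // (∀ i, u i ≠ ⊥) ∧ ∃ i, u i ≠ ⊤}

variable {N}

namespace TropPoint

/-- The sedentarity `{i | uᵢ = +∞}` of a point. [cite: AminiPiquerez2020TropicalHC, §2] -/
def sed (u : TropPoint N) : Finset (Fin N) := Finset.univ.filter fun i ↦ u.1 i = ⊤

/-- The finite coordinates of a point as a real vector (junk value `0` at infinite coordinates; only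
paired with integer forms vanishing there). [folklore] -/
def re (u : TropPoint N) : Fin N → ℝ := fun i ↦ (u.1 i).toReal

end TropPoint

/-- Evaluation `⟨m, x⟩ = Σ mᵢ xᵢ` of an integer linear form on a real vector. [folklore] -/
def linEval (m : Fin N → ℤ) (x : Fin N → ℝ) : ℝ := ∑ i, (m i : ℝ) * x i

variable (N) in
/-- `⟨m, ·⟩` as a linear functional on `ℝ^N`. [folklore] -/
def linFormOf (m : Fin N → ℤ) : (Fin N → ℝ) →ₗ[ℝ] ℝ := ∑ i, (m i : ℝ) • LinearMap.proj i

/-! ### Cells -/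

variable (N) in
/-- A presentation of a relatively open rational polyhedral cell of `𝕋ℙ^{N-1}` of sedentarity `sed`:
`{u | uᵢ = +∞ ↔ i ∈ sed, ⟨m, u⟩ = r ((m, r) ∈ eqs), ⟨m, u⟩ > r ((m, r) ∈ stricts)}`.
[cite: AminiPiquerez2020TropicalHC, §2] -/
structure TropCell where
  /-- the sedentarity: coordinates equal to `+∞` on the cell -/
  sed : Finset (Fin N)
  /-- defining equations `⟨m, u⟩ = r` -/
  eqs : Finset ((Fin N → ℤ) × ℝ)
  /-- defining strict inequalities `⟨m, u⟩ > r` -/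
  stricts : Finset ((Fin N → ℤ) × ℝ)

namespace TropCell

/-- The forms of a cell are translation invariant (`Σ mᵢ = 0`) and do not involve the infinite
coordinates (`m|_sed = 0`). [cite: AminiPiquerez2020TropicalHC, §2] -/
def WellFormed (σ : TropCell N) : Prop :=
  (∀ e ∈ σ.eqs, (∑ i, e.1 i) = 0 ∧ ∀ i ∈ σ.sed, e.1 i = 0) ∧
    ∀ e ∈ σ.stricts, (∑ i, e.1 i) = 0 ∧ ∀ i ∈ σ.sed, e.1 i = 0

/-- The set of points of a cell. [cite: AminiPiquerez2020TropicalHC, §2] -/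
def pts (σ : TropCell N) : Set (TropPoint N) :=
  {u | (∀ i, u.1 i = ⊤ ↔ i ∈ σ.sed) ∧ (∀ e ∈ σ.eqs, linEval e.1 u.re = e.2) ∧
    ∀ e ∈ σ.stricts, e.2 < linEval e.1 u.re}

end TropCell

/-! ### Tangent spaces and the exterior algebra -/

variable (N) in
/-- The subspace `⟨𝟙, eᵢ (i ∈ I)⟩ ⊆ ℝ^N` killed in the tangent space of the stratum of sedentarity
`I`. [cite: MikhalkinZharkov2014Eigenwave, §2.2] -/
def killed (I : Finset (Fin N)) : Submodule ℝ (Fin N → ℝ) :=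
  Submodule.span ℝ (insert (fun _ ↦ (1 : ℝ))
    ((fun i : Fin N ↦ (Pi.single i (1 : ℝ) : Fin N → ℝ)) '' (I : Set (Fin N))))

/-- `⟨𝟙, eᵢ (i ∈ I)⟩ ⊆ ⟨𝟙, eᵢ (i ∈ J)⟩` for `I ⊆ J`. [folklore] -/
theorem killed_mono {I J : Finset (Fin N)} (h : I ⊆ J) : killed N I ≤ killed N J :=
  Submodule.span_mono (Set.insert_subset_insert (Set.image_mono (Finset.coe_subset.mpr h)))

variable (N) in
/-- The tangent space `ℝ^N ⧸ ⟨𝟙, eᵢ (i ∈ I)⟩ ≅ ℝ^{N-1-|I|}` of the stratum of sedentarity `I` of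
`𝕋ℙ^{N-1}`. [cite: MikhalkinZharkov2014Eigenwave, §2.2] -/
abbrev TanQuot (I : Finset (Fin N)) : Type := (Fin N → ℝ) ⧸ killed N I

variable (N) in
/-- The projection `TanQuot I → TanQuot J` for `I ⊆ J` (and `0` otherwise): the differential of the
map to a stratum at infinity. [cite: MikhalkinZharkov2014Eigenwave, §2.1 (the maps ι) and §2.2] -/
def prj (I J : Finset (Fin N)) : TanQuot N I →ₗ[ℝ] TanQuot N J :=
  if h : I ⊆ J then (killed N I).mapQ (killed N J) LinearMap.id (by simpa using killed_mono h)
  else 0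

variable (N) in
/-- The exterior algebra `⋀• TanQuot I`, home of the coefficients `F_p`. [cite:
MikhalkinZharkov2014Eigenwave, §2.2] -/
abbrev Ext (I : Finset (Fin N)) : Type := ExteriorAlgebra ℝ (TanQuot N I)

variable (N) in
/-- `⋀• prj`. [cite: MikhalkinZharkov2014Eigenwave, §2.1 (the maps ι) and §2.2] -/
def emap (I J : Finset (Fin N)) : Ext N I →ₗ[ℝ] Ext N J :=
  (ExteriorAlgebra.map (prj N I J)).toLinearMap

namespace TropCell

/-- The tangent space `T(σ) ⊆ TanQuot σ.sed` of a cell: the common kernel of its equations, modulo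
the killed directions. [cite: MikhalkinZharkov2014Eigenwave, §2.2] -/
def tangent (σ : TropCell N) : Submodule ℝ (TanQuot N σ.sed) :=
  (⨅ e ∈ σ.eqs, LinearMap.ker (linFormOf N e.1)).map (killed N σ.sed).mkQ

/-- The dimension of a cell (of its tangent space). [folklore] -/
def dimc (σ : TropCell N) : ℕ := Module.finrank ℝ (tangent σ)

/-- `⋀ᵏ T(σ) ⊆ ⋀• TanQuot σ.sed`, spanned by the wedges of `k` tangent vectors. [cite:
MikhalkinZharkov2014Eigenwave, Def. 2.1 and §2.2] -/
def wedgeSpan (σ : TropCell N) (k : ℕ) : Submodule ℝ (Ext N σ.sed) :=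
  Submodule.span ℝ (Set.range fun v : Fin k → tangent σ ↦
    ExteriorAlgebra.ιMulti ℝ k fun i ↦ ((v i : tangent σ) : TanQuot N σ.sed))

/-- `τ` is a face of `σ`: `τ ⊆ closure σ` (in the topology of `TropPoint N ⊆ EReal^N`).
[cite: AminiPiquerez2020TropicalHC, §2] -/
def IsFace (τ σ : TropCell N) : Prop := τ.pts ⊆ closure σ.pts

/-- A fixed orientation of a cell: a chosen non-zero element of the line `⋀^{dim σ} T(σ)` (zero if
there is none). [folklore] -/
def orient (σ : TropCell N) : Ext N σ.sed :=
  if h : ∃ o ∈ wedgeSpan σ (dimc σ), o ≠ 0 then h.choose else 0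

/-- An inward vector of the codimension-one face pair `τ ≺ σ`, as a tangent vector of `σ`: for a
face
of the same sedentarity, the class of `u_σ - u_τ` for points `u_σ ∈ σ`, `u_τ ∈ τ`; for a face at
infinity (`sed σ ⊂ sed τ`), MINUS a recession vector of `σ` towards `τ` (a tangent vector supported on
`sed τ ∖ sed σ` with positive entries there). [cite: MikhalkinZharkov2014Eigenwave, §2.2] -/
def IsInward (σ τ : TropCell N) (d : TanQuot N σ.sed) : Prop :=
  (σ.sed = τ.sed ∧ ∃ uσ ∈ σ.pts, ∃ uτ ∈ τ.pts, d = (killed N σ.sed).mkQ (uσ.re - uτ.re)) ∨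
  (σ.sed ⊂ τ.sed ∧ ∃ a : Fin N → ℝ, (∀ j, j ∈ τ.sed → j ∉ σ.sed → 0 < a j) ∧
    (∀ j, ¬ (j ∈ τ.sed ∧ j ∉ σ.sed) → a j = 0) ∧ (killed N σ.sed).mkQ a ∈ tangent σ ∧
    d = -(killed N σ.sed).mkQ a)

/-- A lift to `⋀^{dim τ} T(σ)` of the orientation of the face `τ` along `prj`. [cite:
MikhalkinZharkov2014Eigenwave, §2.2] -/
def IsLift (σ τ : TropCell N) (o : Ext N σ.sed) : Prop :=
  o ∈ wedgeSpan σ (dimc τ) ∧ emap N σ.sed τ.sed o = orient τ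

/-- `orient σ` is a positive multiple of `s • (d ∧ õ_τ)` for an inward vector `d` and a lift `õ_τ`.
[folklore] -/
def HasIncSign (σ τ : TropCell N) (s : ℝ) : Prop :=
  ∃ (d : TanQuot N σ.sed) (o : Ext N σ.sed) (c : ℝ), IsInward σ τ d ∧ IsLift σ τ o ∧ 0 < c ∧
    orient σ = (s * c) • (ExteriorAlgebra.ι ℝ d * o)

/-- The incidence number `[σ : τ] ∈ {0, 1, -1}` of an ordered pair of cells: non-zero only when `τ`
is
a codimension-one face of `σ`, and then the sign comparing `orient σ` with
`(inward vector) ∧ (lifted orient τ)`. [cite: MikhalkinZharkov2014Eigenwave, §2.2] -/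
def inc (σ τ : TropCell N) : ℝ :=
  if IsFace τ σ ∧ dimc σ = dimc τ + 1 then
    (if HasIncSign σ τ 1 then 1 else if HasIncSign σ τ (-1) then -1 else 0)
  else 0

end TropCell

/-! ### Polyhedral structures, multi-tangent spaces, chains, homology -/

open TropCell

/-- `Q` is a polyhedral structure on the set `X ⊆ 𝕋ℙ^{N-1}`: well-formed non-empty pairwise disjoint
cells covering `X`, the closure of each cell being a union of cells. [cite:
AminiPiquerez2020TropicalHC, §2] -/
def IsStructureOf (Q : Finset (TropCell N)) (X : Set (TropPoint N)) : Prop :=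
  (∀ σ ∈ Q, σ.WellFormed ∧ σ.pts.Nonempty) ∧
  (∀ σ ∈ Q, ∀ τ ∈ Q, σ ≠ τ → Disjoint σ.pts τ.pts) ∧
  (⋃ σ ∈ Q, σ.pts) = X ∧
  ∀ σ ∈ Q, ∀ τ ∈ Q, (τ.pts ∩ closure σ.pts).Nonempty → τ.pts ⊆ closure σ.pts

/-- The multi-tangent space `F_p(σ) = Σ_{ρ ∈ Q, σ ≼ ρ, sed ρ = sed σ} ⋀ᵖ T(ρ) ⊆ ⋀• TanQuot (sed σ)`
(coefficients of tropical `(p, ·)`-chains on `σ`). [cite: MikhalkinZharkov2014Eigenwave, Def. 2.1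
and §2.2] -/
def multiTangent (Q : Finset (TropCell N)) (p : ℕ) (σ : TropCell N) : Submodule ℝ (Ext N σ.sed) :=
  ⨆ ρ ∈ Q, ⨆ (_ : IsFace σ ρ ∧ ρ.sed = σ.sed), (wedgeSpan ρ p).map (emap N ρ.sed σ.sed)

/-- Cellular cochains-of-coefficients: one element of `⋀• TanQuot (sed σ)` per cell of `Q`. [cite:
MikhalkinZharkov2014Eigenwave, §2.2] -/
abbrev CellChain (Q : Finset (TropCell N)) : Type := (σ : ↥Q) → Ext N σ.1.sed

/-- The tropical cellular `(p, q)`-chains `C_{p,q}(Q) = ⊕_{dim σ = q} F_p(σ)`. [cite: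
MikhalkinZharkov2014Eigenwave, §2.2] -/
def chains (Q : Finset (TropCell N)) (p q : ℕ) : Submodule ℝ (CellChain Q) :=
  Submodule.pi Set.univ fun σ : ↥Q ↦ if dimc σ.1 = q then multiTangent Q p σ.1 else ⊥

/-- The cellular boundary `(∂c)(τ) = Σ_σ [σ : τ] • prj (c σ)`. [cite: MikhalkinZharkov2014Eigenwave,
§2.2 (cellular boundary)] -/
def boundary (Q : Finset (TropCell N)) : CellChain Q →ₗ[ℝ] CellChain Q :=
  LinearMap.pi fun τ : ↥Q ↦
    ∑ σ : ↥Q, (inc σ.1 τ.1) • ((emap N σ.1.sed τ.1.sed).comp (LinearMap.proj σ))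

/-- Cellular tropical `(p, q)`-cycles `Z_{p,q} = C_{p,q} ∩ ker ∂`. [cite:
MikhalkinZharkov2014Eigenwave, §2.2] -/
def cycles (Q : Finset (TropCell N)) (p q : ℕ) : Submodule ℝ (CellChain Q) :=
  chains Q p q ⊓ LinearMap.ker (boundary Q)

/-- Cellular tropical `(p, q)`-boundaries `B_{p,q} = ∂ C_{p,q+1}`. [cite:
MikhalkinZharkov2014Eigenwave, §2.2] -/
def boundaries (Q : Finset (TropCell N)) (p q : ℕ) : Submodule ℝ (CellChain Q) :=
  (chains Q p (q + 1)).map (boundary Q)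

/-- Cellular tropical homology `H_{p,q}(Q; ℝ) = Z_{p,q} ⧸ (B_{p,q} ∩ Z_{p,q})`. [cite:
MikhalkinZharkov2014Eigenwave, §2.2 and Prop. 2.2] -/
abbrev tropHomology (Q : Finset (TropCell N)) (p q : ℕ) : Type :=
  ↥(cycles Q p q) ⧸ (boundaries Q p q).comap (cycles Q p q).subtype

/-- The fundamental chain `σ ↦ w σ • orient σ` (on `p`-cells) of a real weighting `w`. [cite:
MikhalkinZharkov2014Eigenwave, Def. 4.2 and Prop. 4.3] -/
def fundChain (Q : Finset (TropCell N)) (p : ℕ) (w : ↥Q → ℝ) : CellChain Q :=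
  fun σ ↦ if dimc σ.1 = p then w σ • orient σ.1 else 0

/-- A tropical `p`-cycle subordinate to `Q`: a real weighting of the `p`-cells whose fundamental
chain
is a cellular `(p, p)`-cycle (closedness of the fundamental chain is the balancing condition).
[cite: MikhalkinZharkov2014Eigenwave, Def. 4.2 and Prop. 4.3] -/
structure TropCycle (Q : Finset (TropCell N)) (p : ℕ) where
  /-- the weights -/
  weight : ↥Q → ℝ
  /-- the fundamental chain is a `(p, p)`-cycle -/
  mem_cycles : fundChain Q p weight ∈ cycles Q p p

namespace TropCycle

variable {Q : Finset (TropCell N)} {p : ℕ}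

/-- The class `[C] ∈ H_{p,p}(Q; ℝ)` of a tropical cycle. [cite: MikhalkinZharkov2014Eigenwave, Def.
4.2 and Prop. 4.3] -/
def cls (C : TropCycle Q p) : tropHomology Q p p :=
  Submodule.Quotient.mk ⟨fundChain Q p C.weight, C.mem_cycles⟩

/-- The support of a tropical cycle: the union of the closed `p`-cells with non-zero weight.
[folklore] -/
def support (C : TropCycle Q p) : Set (TropPoint N) :=
  ⋃ (σ : ↥Q) (_ : dimc σ.1 = p ∧ C.weight σ ≠ 0), closure σ.1.pts

end TropCycle

/-! ### Extended tropical hypersurfaces and regular unimodular subdivisions -/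

/-- The value `ht s + ⟨s, u⟩ ∈ ℝ ∪ {+∞}` of the tropical monomial of exponent `s` at `u`
(`+∞` as soon as an infinite coordinate occurs with positive exponent). [cite:
MaclaganSturmfels2015, §3.1] -/
def termVal (ht : (Fin N →₀ ℕ) → ℝ) (s : Fin N →₀ ℕ) (u : TropPoint N) : EReal :=
  if ∃ i, s i ≠ 0 ∧ u.1 i = ⊤ then ⊤ else ((ht s + ∑ i, (s i : ℝ) * (u.1 i).toReal : ℝ) : EReal)

/-- The extended tropical hypersurface in `𝕋ℙ^{N-1}` of the tropical polynomial
`min_{s ∈ S} (ht s + ⟨s, u⟩)`: the minimum is finite and attained at least twice.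
[cite: MaclaganSturmfels2015, §3.1 and §6.2] -/
def tropHypersurface (S : Finset (Fin N →₀ ℕ)) (ht : (Fin N →₀ ℕ) → ℝ) : Set (TropPoint N) :=
  {u | ∃ s ∈ S, ∃ s' ∈ S, s ≠ s' ∧ termVal ht s u = termVal ht s' u ∧ termVal ht s u ≠ ⊤ ∧
    ∀ s'' ∈ S, termVal ht s u ≤ termVal ht s'' u}

/-- The cell of the regular subdivision of `(S, ht)` selected by `y ∈ ℝ^N`: the exponents minimising
`ht s - ⟨y, s⟩` (a lower face of the lifted point set). [cite: MaclaganSturmfels2015, §2.3] -/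
def lowerFace (S : Finset (Fin N →₀ ℕ)) (ht : (Fin N →₀ ℕ) → ℝ) (y : Fin N → ℝ) :
    Finset (Fin N →₀ ℕ) :=
  S.filter fun s ↦ ∀ s' ∈ S, ht s - ∑ i, y i * (s i : ℝ) ≤ ht s' - ∑ i, y i * (s' i : ℝ)

/-- The exponent vectors of `C` as real points. [folklore] -/
def realPts (C : Finset (Fin N →₀ ℕ)) : Set (Fin N → ℝ) :=
  (fun s i ↦ ((s i : ℕ) : ℝ)) '' (C : Set (Fin N →₀ ℕ))

/-- The lattice `ℤ⟨C - C⟩ ⊆ ℤ^N` generated by the differences of the exponent vectors of `C`.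
[folklore] -/
def diffLattice (C : Finset (Fin N →₀ ℕ)) : AddSubgroup (Fin N → ℤ) :=
  AddSubgroup.closure {v | ∃ s ∈ C, ∃ s' ∈ C, v = fun i ↦ ((s i : ℕ) : ℤ) - ((s' i : ℕ) : ℤ)}

/-- The regular subdivision of `(S, ht)` is a triangulation all of whose full-dimensional cells are
simplices unimodular for the lattice `ℤ⟨S - S⟩`: every lower face affinely spanning `aff S` has
exactly `N` vertices and its differences generate `ℤ⟨S - S⟩` (for `S` affinely spanning a hyperplane
of `ℝ^N`, e.g. containing the `d eᵢ`). Equivalently: the dual tropical hypersurface is smooth for the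
dual lattice. [cite: MaclaganSturmfels2015, §2.3 and §4.5] -/
def RegularUnimodular (S : Finset (Fin N →₀ ℕ)) (ht : (Fin N →₀ ℕ) → ℝ) : Prop :=
  ∀ y : Fin N → ℝ, affineSpan ℝ (realPts (lowerFace S ht y)) = affineSpan ℝ (realPts S) →
    (lowerFace S ht y).card = N ∧ diffLattice (lowerFace S ht y) = diffLattice S

end Literature.AlgebraicGeometry.Tropical

end
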